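import Summits.CriticalPhenomena.CardyFormulaZ2.Theses.CardyIKTransport
import Summits.CriticalPhenomena.CardyFormulaZ2.Theses.CardyDiluteOrbit
import Literature.Probability.RandomPlanarGeometry.ConformalRectangleProofs
import Literature.Probability.RandomPlanarGeometry.CardyFunctionIncBeta
import Literature.Probability.RandomPlanarGeometry.DiscRectangles

/-!
# Disproof work file — crux `CornerLineDescent` (stmt-CriticalPhenomena-10964, route `CardyIKTransport`, rank 3)

cdisprove unit `refuter-cdisprove-stmt-CriticalPhenomena-10964-0`, cycle 1 (2026-08-16).
`lean check`: see NOTES; prose lives in docstrings only.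

## Findings

* §A LOGICAL SHAPE.  `CornerLineDescent ↔ (CardyIK → CrudeBondCardy)` (`cornerLineDescent_iff`,
  `Iff.rfl`): the antecedent is VERBATIM the sibling route's crux `CardyDiluteOrbit.CardyIK`
  (stmt-5913) and the consequent `CrudeBondCardy` (Cardy for bond-ℤ² at `p = ½`, crude event
  `embDomainCrossing` at the standard embedding `√2·(x₀ + i x₁)`, every conformal rectangle) is
  verbatim the antecedent of `CrudeToCanonical` (stmt-4968) and the consequent of
  `RenewalGridHarmless` (stmt-4967).  Hence (`not_cornerLineDescent_iff`) a refutation must PROVE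
  `CardyIK` (Cardy for the isotropic Izergin–Korepin gauge — open, difficulty XL) AND REFUTE crude
  bond-ℤ² Cardy (the conjunct-strength statement every route of this sub-problem wants, believed
  true; numerics agree).  The crux is structurally unfalsifiable short of that; it is also implied
  outright by its own consequent (`cornerLineDescent_of_crudeBondCardy`: the hypothesis is used
  only by the MECHANISM, never by the statement) and by the sibling o(1)-bridge
  `CardyDiluteOrbit.IKBondBridge` (stmt-5914) (`cornerLineDescent_of_ikBondBridge`); conversely
  under `CardyIK` the two cruxes coincide (`cornerLineDescent_iff_ikBondBridge`).
* §B LOAD-BEARING ANALYSIS.  The only hypothesis is `CardyIK`; dropping it leaves `CrudeBondCardy`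
  itself (`CornerLineDescentWithoutIK`), which cannot be refuted here (it is the target).  What IS
  refutable is every MODEL-BLIND strengthening: §C.
* §C MODEL-BLIND STRENGTHENINGS ARE FALSE (proved, sorry-free): (C1) `not_blind_transport` — "Cardy
  for one crossing family ⇒ Cardy for another" fails (P := Cardy value of the modulus, Q := 0);
  (C2) `not_transport_under` — for EVERY property `Symm` of crossing families enjoyed by the
  constant family `½` (quarter-turn / dihedral invariance as in `IKQuarterTurn`, exact self-duality
  `Q R δ + Q R† δ = 1`, translation covariance, values in `[0,1]`, …), "Cardy P ∧ Symm Q ⇒ Cardy Q"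
  fails, witnessed on the disc rectangle `(𝔻; 1, e^{iπ/3}, −1, −e^{iπ/3})` of modulus `η = 1/4`
  (`exists_rect_crossRatio_quarter`, explicit Cayley datum from `DiscRectangles`) where
  `F(1/4) < F(1/2) = 1/2` (`cardyFunction_half`, `cardyFunction_quarter_lt_half`).  Moral for the
  provers: the route's sentence "both ends are D₄-symmetric, so a transport up to a linear map along
  the line is again closed by AnchorByRigidity-type rigidity" is only the LAST step; exact
  self-duality + D₄ of every `M(t,½)` pins the square crossing to `½` and nothing else — the whole
  content of the crux is a genuine transport/universality statement along `t ∈ [0, √3/2]`.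
* §D THE CORNER LINE HAS NO MONOTONE STRUCTURE (one-face algebra of the free corner-fugacity
  weight `t^{[odd face]}` = the 2×2 marginal of the route's i.i.d. gauge, `p = t/(1+t)`; all
  sorry-free): `faceZ` `= 8(1+t)`; any three of the four cells of a face are i.i.d. fair
  (`face_three_cells_uniform`: the colour field is 3-wise independent for EVERY t — pairwise
  statistics cannot see `t`); the increasing events `{SW ∨ NE black}` and `{SE ∧ NW black}` are
  NEGATIVELY correlated for `0 ≤ t < 1`, `Cov = −(1−t)/(16(1+t))` (`face_negative_association`,
  `face_cov_formula`) — no FKG/Harris anywhere on the segment `t ∈ [0,1)`, in particular at the IK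
  point `√3/2` and at the freezing point `0`; and the family is NOT stochastically ordered in `t`:
  `P_t[≥ 3 of 4 black] = (1+4t)/(8(1+t))` increases while `P_t[4 black] = 1/(8(1+t))` decreases
  (`face_no_stochastic_order`), so by Strassen no monotone coupling of `M(t,½)`, `M(t',½)` exists
  for `t ≠ t'` (equal one-cell marginals `½` would force equality).  Consequences: CornerIrrelevance
  cannot be run as a Grimmett–Manolescu/Russo monotone interpolation in `t`, nor by FKG-based RSW
  gluing; any proof needs a non-monotone comparison (coupling by XOR of sparse defect fields,
  renormalisation, or the transport-plus-rigidity template of r2).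
* §E NUMERICS (kit jobs, exact i.i.d.-gauge sampling of `M(t,½)` in `2L × L` boxes, long-way
  crossing vs Cardy `0.17565`; square boxes `= ½` exactly as a sampler check): see the docstring of
  `numerics_note` below (filled in when the jobs return; job ids there).
* §F STRUCTURAL REFORMULATION (prose; bears on HOW a proof could go): **`M(t,½)` is critical bond
  percolation on the square lattice with a density `p = t/(1+t)` of quenched DISLOCATIONS.**  In the
  i.i.d. gauge the walls (colour-change edges of the cell grid) form a translation-invariant
  rectilinear arrangement: along each column boundary the vertical-wall indicator is a stationary
  two-state chain in the height flipping exactly at the Bernoulli(`p`) defects of that boundary,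
  likewise along row boundaries, the two families coupled only by sharing flip locations; so every
  grid vertex is a crossing (4 walls), straight (2 opposite), empty, or — exactly at a defect — a TURN
  (2 adjacent walls).  Faces of the arrangement are 2-coloured; a black face is a connected set of
  black cells; two black faces meet only at crossing (checkerboard) vertices, where the fair coin
  decides.  Hence the black clusters of `M(t,½)` are the clusters of QUENCHED BOND PERCOLATION AT `½`
  (the coins) on the random plane graph `G_B(ω)` of black faces (edges = crossing vertices), in
  matching-pair duality with the white-face graph `G_W` (exactly one diagonal pair is joined at each
  crossing; Hex lemma `cellCrossing_duality` of `CellGridSaddlePercolation`; on components of the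
  arrangement without islands it is the medial graph of the pair), and `G_W = G_B` in law (colour
  flip): law-self-dual, square crossings `= ½` exactly.
  Away from turn vertices the arrangement is locally a product grid, so `G_B` is locally the
  (45°) square lattice; at a turn the three same-coloured cells form an L-tromino face with FIVE
  crossing corners next to a unit face with THREE: a degree-5 vertex bound to a triangular face of
  `G_B` (or dually) — a lattice DISLOCATION (the end of an inserted/removed half-line of the grid:
  toggling `d_f` flips the colours of a quadrant, which inside the quadrant swaps primal and dual
  lattices and along the two seams contracts/inserts a half-column and a half-row).  `t = 0`: no
  dislocations, `G_B = ℤ²` on the renewal product grid (the route's FreezeIdentification);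
  `t = √3/2`: dislocation density `2√3 − 3 ≈ 0.464` per vertex.  So CornerIrrelevance is the
  statement that quenched dislocation disorder of ANY density is irrelevant for critical planar bond
  percolation (Cardy limits unchanged) — a Voronoi-type universality problem, open even for Voronoi
  percolation beyond the `½`-crossing of squares (quenched `= ` annealed `= ½`: Ahlberg–Griffiths–
  Morris–Tassion, Adv. Math. 286 (2016) 889–911, arXiv:1501.04075; conformal invariance open).  The renormalisation-group expectation is
  irrelevance: by §G each defect is, in law, a LOCAL perturbation of the Gibbs weight (it couples to
  the local energy/four-arm sector), and "weak, locally correlated randomness which couples to the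
  local energy is irrelevant if `dν > 2`" (Harris criterion; Cardy, *Scaling and Renormalization in
  Statistical Physics* (1996), §8.2, eqs. (8.12)–(8.13), p. 148, read: `y = 2/ν − d`), here
  `ν = 4/3`, `y = −1/2` — a heuristic for WEAK disorder, while the IK point has defect density `0.46`.  Caution on the `t = 0` end: it is the fair coins at the
  `≍ δ^{-2}` crossings that make the plaid endpoint Bernoulli; a plaid/XOR structure with only
  linear entropy can leave the universality class altogether (corner percolation, Pete, Ann. Probab.
  36 (2008), arXiv:math/0507457).  LEVER it exposes: conditionally on the colours (= on the
  lattice `G_B`) the coins are i.i.d., so crossing events are increasing in the coins and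
  Harris–FKG / BK / Russo IN THE COINS hold conditionally; the missing FKG of §D concerns the
  colours (the lattice) only.
* §G RUSSO IN `t` IS LAW-LOCAL (prose; CORRECTED 02:40Z — an earlier version of this bullet spoke
  of an "L-shaped seam of inverted corner weights": wrong, see below).  In the gauge `t` IS a product
  parameter (`p = t/(1+t)` of the defect bits), so `d/dp P_p[A] = Σ_f I_f` with SIGNED influences
  `I_f = P[A | d_f = 1] − P[A | d_f = 0]`.  Pathwise, toggling `d_f` flips all colours of a quadrant;
  but the push-forward of the free measure under that flip changes the parity of EXACTLY ONE face —
  `f` itself (every other face meets the quadrant in 0, 2 or 4 cells) — so AT THE LEVEL OF LAWS one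
  defect = the corner fugacity inverted (`t ↦ 1/t`) at the single face `f`, equivalently
  `I_f = Cov_t(1_A, κ_f) / (p(1−p))`, the covariance of the crossing indicator with the LOCAL parity
  `κ_f` under `M(t,½)`; there is no seam in law (seams are artefacts of pathwise couplings, pure
  gauge).  Consequences.  (1) For `t > 0` the natural size is the local-operator response
  `|I_f| ≍ δ^{x}` with `x = x₄ = 5/4` (thermal = four-arm in percolation) unless a selection rule
  kills that amplitude; then `Σ_f I_f ≍ δ^{x−2} = δ^{−3/4}`: t-independence via single-bit Russo
  needs `x > 2`, and `2 − x₄ = 3/4` is EXACTLY the route's "3/4-rate residue" (the analogue of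
  Beffara's `Δ(v) = o(δ²)` in `Literature.Barriers.CriticalPhenomena.CoveringLatticeShift`, now for a
  colour-even, `D₄(f)`-symmetric seed).  The card `symmetric-seed-second-order` bets on the selection
  rule (four-arm amplitude of `κ_f` zero by `ι = 𝒟 ∘ rot_{π/2}(f)`-oddness, next channel six-arm,
  `x ≥ 35/12 > 2`) — that rule is its load-bearing claim.  (2) At the frozen end the same `I_f` is
  "one dislocation inserted into bond-ℤ² on the renewal grid vs none": law-local in the gauge sense
  but with NO local pathwise coupling (a dislocation is topological), so a priori
  `x₀ ∈ {1/4 (seam × four-arm coupling bound), 1 (unit-shear boundary displacement), 5/4 (core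
  four-arm), …}`; `RegimeOne` (card `dislocation-gas-endgame`: `c/δ` dislocations cost `o(1)` for
  every `c`) needs `x₀ > 1` uniformly, `FiniteDislocationsHarmless` only `x₀ > 0`,
  `SparseDislocationsHarmless` reaches `p ≪ δ^{2−x₀}`.  (3) MEASURABLE: kit `j013852` (centre) and `j013862` (bottom boundary) fit
  `|I_f(L)| ~ L^{−x}` for one forced corner at the centre / left quarter of `2L × L` boxes in the
  `t = 0` and `t = 0.1` backgrounds, `L = 8 … 128`, plus a bottom-boundary position (paired sampling; exact anchors at `4×2`, `6×3`
  by enumeration): `x ≈ 1/4` kills RegimeOne's union bound, `x ≈ 5/4` kills the selection rule of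
  `symmetric-seed-second-order` (and leaves the 3/4 wall standing), `x > 2` keeps that card alive.
* §G(4) BULK VS BOUNDARY (prose; CORRECTED 07:55Z after the boundary data of §E(iii) — an
  earlier version called the boundary layer "marginal, exponent 1": wrong exponent).  BULK: the
  selection rule is plausible — condition on a four-arm configuration at `f` with black arms to two
  opposite sides; the involution `ι = (colour flip ∘ coin flip) ∘ rot_{π/2}(f)` preserves `M(t,½)`
  and that arm event, fixes `κ_f`, and exchanges "the black pair is joined through the
  neighbourhood of `f`" with its complement (Hex duality at `f`), so given the arms the local parity
  cannot bias which pair connects: zero four-arm amplitude of `Cov(1_A, κ_f)` for EVERY bulk `f`, at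
  every `t` including the frozen end (measured: effective exponent `≈ 1.9`, §E(iii)).  BOUNDARY
  LAYER: `ι` is broken near `∂Ω`, but the pivotality of a local perturbation at a point of a free OR
  of a crossing arc needs THREE half-plane arms (black–black–white resp. white–black–white),
  exponent `j(j+1)/6 = 2` for `j = 3` — not the two-arm exponent `1` — so the boundary layer's Russo
  sum is `≍ δ^{-1}·δ^{2} = δ → 0` before any cancellation (measured at the bottom mid-point:
  `|I_f| = .0067 (L=8) → .0037 (12) → .0015 (16) → 0 ± .001`, effective exponent `≈ 2`, §E(iii)).
  Hence for a single-bit Russo line the ENTIRE weight sits on the bulk exponent: `Σ_f I_f ≍ δ^{x−2}`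
  needs `x > 2` strictly; the data give `x_eff ≈ 1.9 ± 0.2` over `L = 2…16` and cannot decide between
  a log-marginal `x = 2` and the card's `x ≥ 35/12`.  That — and nothing at the boundary — is the
  precise residual of the `3/4` wall on the corner line.
* §H ROUND-1 IDEAS, CHEAP CHECKS (2026-08-16T02:10Z; cards in `Ideas/`).  (i) `symmetric-seed-second-order`
  First lemma "`Cov_t(1_{LR}, κ_f) = 0` on a square centred at `f`": TRUE for every `t` and size, by
  the measure-preserving involution `Φ = (colour flip) ∘ rot_{π/2}(f)` (`1_{LR} ∘ Φ = 1 − 1_{LR}` by the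
  Hex lemma, `κ_f ∘ Φ = κ_f`) — but ONLY for the centre of a square; on a `2:1` box the signed
  influence of a single corner is generically non-zero (exact 4×2 values in §E vary with `t`).
  (ii) `poisson-corner-refinement-tower` DecimationIdentity (`kℤ × kℤ` sub-colouring of `M(p)` has the
  law of `M(p′)`, `1 − 2p′ = (1 − 2p)^{k²}`): TRUE in the gauge (block parities of i.i.d. defects are
  i.i.d.; `A∘(k·)`, `B∘(k·)` i.i.d. fair) — a statement about COLOUR laws only, connectivity is not
  decimated.  (iii) `sharp-seam-chimera` "column differences `σ(S,y) ⊕ σ(S,y+1)` are i.i.d. fair for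
  every `t`": TRUE (character argument; in the gauge they are `B_y ⊕ B_{y+1} ⊕` independent strip
  parities).  (iv) CONTRADICTION BETWEEN CARDS on the regime `p = λδ²` (finitely many dislocations in
  the domain): `dislocation-seam-calculus` claims `FiniteDislocationsHarmless` (one dislocation costs
  `≲` seam × four-arm `= δ^{1/4} → 0`), `sharp-seam-chimera` NOTES BN2 claims an `O(1)` deformation
  `Cardy_λ`.  At most one is right.  The disprover's bet: finitely many dislocations are invisible in
  the limit (a dislocation is curvature-free — a bound 5/3 pair —, the lattice is locally `ℤ²` off the
  core, and in Smirnov-type arguments an isolated core is a removable singularity of the bounded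
  limit functions), so BN2 is the claim at risk; and `dislocation-gas-endgame`'s RegimeOne uses the
  per-defect bound `|I_f| ≲ π₄(δ,1) ≈ δ^{5/4}` (core only), i.e. `x₀ ≥ 5/4` in the notation of §G(2) —
  consistent with law-locality, unproved, and exactly what `j013852` measures.  TEST FILED: kit `j013852` + `j013862` (paired MC, signed influence `I_f(L)` of
  ONE forced corner at the centre / left quarter of `2L × L` boxes, `t ∈ {0, 0.1}`, `L = 8 … 128`, fit
  `|I_f| ~ L^{−x}`): `x ≈ 1/4` = naive seam, `x ≳ 1` = displacement/core pictures, `x ≈ 0` = BN2.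
* NUMERICS VERDICT (cycle 1, §E): the corner line is numerically ONE universality class — every
  `M(t,½)`, `t ∈ {0, .02, .05, .1, .25, .5, √3/2, 1}`, has the `2:1` long-way crossing at Cardy's
  `0.1756` within `±0.002–0.004` (pooled `L ≥ 128` overall `0.1745 ± 0.0007`; IK point
  `0.1758 ± 0.0012` from `1.1·10⁵` boxes); the crossover in `c = pL` is flat over `[0.6, 100]`;
  finite-size corrections are non-monotone in `t`; the signed one-corner response decays with
  effective exponent `≈ 1.9` in the bulk (four-arm rate excluded) and `≈ 2` at a free arc.  None of
  this can refute or prove a limit statement; it removes the cheap kills (kill criteria (i), (iii) of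
  the route do not fire numerically) and calibrates the cards' quantitative bets.
* VERDICT (cycle 1): RESISTS.  No degenerate instance exists (the statement has no free parameter);
  no junk in the typing (antecedent/consequent are the genuine crude-event Cardy statements; `2δ`
  slack ≥ both mesh-edge lengths `√2·δ`, `δ·√2`; `Set.projIcc` does not clamp `2√3−3 ∈ (0,1)`;
  `μ.real` of a finite-coordinate event); the only kills are `CardyIK ∧ ¬CrudeBondCardy`.
-/

noncomputable section

open MeasureTheory Filter Topology Set Complex
open Literature.Probability.LatticeModels Literature.Probability.RandomPlanarGeometry
open Literature.Probability.Percolation hiding cardyFunction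

namespace Summit.CriticalPhenomena.CardyFormulaZ2.Cruxes.CornerLineDescent.Disproof

open Summit.CriticalPhenomena.CardyFormulaZ2.Theses

/-! ## §A Logical shape of the crux -/

/-- The consequent of the crux: Cardy's formula for bond percolation on `ℤ²` at `p = ½`, crude
embedded crossing event at the standard embedding, in every conformal rectangle (verbatim the
antecedent of `CardyIKTransport.CrudeToCanonical`). [folklore] -/
def CrudeBondCardy : Prop :=
  ∀ R : ConformalRectangle, R.HasCrossingLimit (fun δ ↦ (bondPercolation (zdGraph 2) half).real
    (embDomainCrossing squareLatticeEmbedding.z R.carrier δ (R.arc 0) (R.arc 2))) cardyFunction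

/-- The crux is `CardyIK → CrudeBondCardy`, by `Iff.rfl` (the inline gauge of the antecedent is
character-for-character `CardyDiluteOrbit.CardyIK`, stmt-CriticalPhenomena-5913). [folklore] -/
theorem cornerLineDescent_iff :
    CardyIKTransport.CornerLineDescent ↔ (CardyDiluteOrbit.CardyIK → CrudeBondCardy) :=
  Iff.rfl

/-- What a refutation must deliver: Cardy for the IK gauge AND the failure of crude bond-ℤ²
Cardy. [folklore] -/
theorem not_cornerLineDescent_iff :
    ¬ CardyIKTransport.CornerLineDescent ↔ (CardyDiluteOrbit.CardyIK ∧ ¬ CrudeBondCardy) := by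
  rw [cornerLineDescent_iff, Classical.not_imp]

/-- The hypothesis is decoration at the level of the STATEMENT: the consequent alone proves the
crux (it is used only by the intended mechanism). [folklore] -/
theorem cornerLineDescent_of_crudeBondCardy (h : CrudeBondCardy) :
    CardyIKTransport.CornerLineDescent := fun _ ↦ h

/-- The consequent is verbatim the antecedent of the support item `CrudeToCanonical`
(stmt-CriticalPhenomena-4968). [folklore] -/
theorem crudeToCanonical_iff :
    CardyIKTransport.CrudeToCanonical ↔
      (CrudeBondCardy → ∀ R : ConformalRectangle,
        R.HasCrossingLimit (bondDomainCrossingProb R) cardyFunction) :=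
  Iff.rfl

/-- The sibling crux `IKBondBridge` (stmt-CriticalPhenomena-5914: the crude IK and bond-ℤ²
crossing probabilities differ by `o(1)`, same embedding) implies the crux: limits transfer along a
vanishing difference. [folklore] -/
theorem cornerLineDescent_of_ikBondBridge (h : CardyDiluteOrbit.IKBondBridge) :
    CardyIKTransport.CornerLineDescent := by
  intro hIK R φ x hφx
  have h1 := hIK R φ x hφx
  have h2 := h R
  have h3 := h1.sub h2
  simpa using h3

/-- Conversely, Cardy for both families gives the `o(1)` bridge (uniformizing data exist for
every conformal rectangle, `MarkedDomain.exists_isUniformizing_holds`). [folklore] -/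
theorem ikBondBridge_of_cardyIK_of_crudeBondCardy (hIK : CardyDiluteOrbit.CardyIK)
    (hB : CrudeBondCardy) : CardyDiluteOrbit.IKBondBridge := by
  intro R
  obtain ⟨φ, x, hφx⟩ := MarkedDomain.exists_isUniformizing_holds R
  have h1 := hIK R φ x hφx
  have h2 := hB R φ x hφx
  have h3 := h1.sub h2
  simpa using h3

/-- Under the antecedent the two sibling cruxes (this route's `CornerLineDescent`, stmt-10964, and
`CardyDiluteOrbit.IKBondBridge`, stmt-5914) are EQUIVALENT: pooled provers attack one statement.
[folklore] -/
theorem cornerLineDescent_iff_ikBondBridge (hIK : CardyDiluteOrbit.CardyIK) :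
    CardyIKTransport.CornerLineDescent ↔ CardyDiluteOrbit.IKBondBridge :=
  ⟨fun h ↦ ikBondBridge_of_cardyIK_of_crudeBondCardy hIK (h hIK),
    cornerLineDescent_of_ikBondBridge⟩

/-! ## §B Load-bearing analysis

The crux has exactly one hypothesis.  Dropping it: -/

/-- `CornerLineDescent` with its hypothesis `CardyIK` dropped is the crude bond-ℤ² Cardy statement
itself — the conjunct-strength target (Schramm, ICM 2006, Problem 2.11, crude-event form), believed
TRUE; no `_false_without_` theorem can exist unless Cardy's formula fails for bond-ℤ².  Recorded as a
definition only. [folklore] -/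
def CornerLineDescentWithoutIK : Prop := CrudeBondCardy

/-- Trivial bookkeeping: the weakened statement is equivalent to the consequent and implies the
crux. [folklore] -/
theorem cornerLineDescent_of_without (h : CornerLineDescentWithoutIK) :
    CardyIKTransport.CornerLineDescent :=
  cornerLineDescent_of_crudeBondCardy h

/-! ## §C Model-blind strengthenings are false

A chosen conformal modulus `eta R` for every conformal rectangle, and one explicit rectangle of
modulus `1/4`. -/

/-- A cross-ratio modulus of `R`, read off one uniformizing datum chosen by `Classical.choose`
(data exist: Riemann mapping + Carathéodory, `MarkedDomain.exists_isUniformizing_holds`). [folklore] -/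
def eta (R : ConformalRectangle) : ℝ :=
  crossRatio (Classical.choose (Classical.choose_spec (MarkedDomain.exists_isUniformizing_holds R)))

/-- Every uniformizing datum of `R` has cross-ratio `eta R` (conformal invariance of the modulus,
`ConformalRectangle.crossRatio_eq_of_isUniformizing_holds`). [folklore] -/
theorem crossRatio_eq_eta {R : ConformalRectangle}
    {φ : ConformalEquiv UpperHalfPlane.upperHalfPlaneSet R.carrier} {x : Fin 4 → ℝ}
    (h : R.IsUniformizing φ x) : crossRatio x = eta R :=
  ConformalRectangle.crossRatio_eq_of_isUniformizing_holds h
    (Classical.choose_spec (Classical.choose_spec (MarkedDomain.exists_isUniformizing_holds R)))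

/-- The constant-in-`δ` family "Cardy value of the modulus" has Cardy limits in every conformal
rectangle. [folklore] -/
theorem hasCrossingLimit_cardy_eta (R : ConformalRectangle) :
    R.HasCrossingLimit (fun _ ↦ cardyFunction (eta R)) cardyFunction := by
  intro φ x hφx
  rw [crossRatio_eq_eta hφx]
  exact tendsto_const_nhds

/-- `F(1/2) = 1/2` (duality symmetry `F(1-η) = 1 - F(η)` at `η = 1/2`). [folklore] -/
theorem cardyFunction_half : cardyFunction (1 / 2) = 1 / 2 := by
  have h := cardyFunction_one_sub_holds (η := 1 / 2) ⟨by norm_num, by norm_num⟩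
  norm_num at h
  linarith

/-- `0 < F(1/4) < 1/2` (`F` strictly increasing on `[0,1]`, `F 0 = 0`, `F(1/2) = 1/2`). [folklore] -/
theorem cardyFunction_quarter_lt_half :
    0 < cardyFunction (1 / 4) ∧ cardyFunction (1 / 4) < 1 / 2 := by
  have hmono := strictMonoOn_cardyFunction_holds
  have h0 : (0 : ℝ) ∈ Icc (0 : ℝ) 1 := ⟨le_rfl, zero_le_one⟩
  have hq : (1 / 4 : ℝ) ∈ Icc (0 : ℝ) 1 := ⟨by norm_num, by norm_num⟩
  have hh : (1 / 2 : ℝ) ∈ Icc (0 : ℝ) 1 := ⟨by norm_num, by norm_num⟩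
  constructor
  · have := hmono h0 hq (by norm_num)
    rwa [cardyFunction_zero] at this
  · have := hmono hq hh (by norm_num)
    rwa [cardyFunction_half] at this

/-- An explicit conformal rectangle of modulus `1/4`: the unit disc marked at
`1, e^{iπ/3}, -1, -e^{iπ/3}` (`ConformalRectangle.symmDisc 0 (1/6)`), with its Cayley uniformizing
datum (`ConformalRectangle.exists_isUniformizing_of_symm`, cross-ratio `(1 - cos (π/3))/2`). [folklore] -/
theorem exists_rect_crossRatio_quarter :
    ∃ (R : ConformalRectangle) (φ : ConformalEquiv UpperHalfPlane.upperHalfPlaneSet R.carrier)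
      (x : Fin 4 → ℝ), R.IsUniformizing φ x ∧ crossRatio x = 1 / 4 := by
  have hs : (1 / 6 : ℝ) ∈ Ioo (0 : ℝ) (1 / 2) := ⟨by norm_num, by norm_num⟩
  set R : ConformalRectangle := ConformalRectangle.symmDisc 0 (1 / 6) hs with hR
  set ζ : ℂ := exp (((0 : ℝ) : ℂ) * I) with hζ
  set u : ℂ := exp (((2 * Real.pi * (1 / 6 : ℝ) : ℝ) : ℂ) * I) with hu
  have hζ_norm : ‖ζ‖ = 1 := by rw [hζ]; exact norm_exp_ofReal_mul_I _
  have hu_norm : ‖u‖ = 1 := by rw [hu]; exact norm_exp_ofReal_mul_I _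
  have harg : 2 * Real.pi * (1 / 6 : ℝ) = Real.pi / 3 := by ring
  have hu_re : u.re = 1 / 2 := by
    rw [hu, exp_ofReal_mul_I_re, harg, Real.cos_pi_div_three]
  have hu_im : u.im ≠ 0 := by
    rw [hu, exp_ofReal_mul_I_im, harg, Real.sin_pi_div_three]
    positivity
  have hp0 : R.pt 0 = ζ := ConformalRectangle.symmDisc_pt_zero 0 (1 / 6) hs
  have hp1 : R.pt 1 = u * ζ := ConformalRectangle.symmDisc_pt_one 0 (1 / 6) hs
  have hp2 : R.pt 2 = -ζ := ConformalRectangle.symmDisc_pt_two 0 (1 / 6) hs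
  have hp3 : R.pt 3 = -(u * ζ) := ConformalRectangle.symmDisc_pt_three 0 (1 / 6) hs
  obtain ⟨φ, x, hUx, hcrx⟩ := R.exists_isUniformizing_of_symm (ConformalEquiv.refl (Metric.ball 0 1))
    (Ψ := id) continuousOn_id (fun _ _ ↦ rfl) hζ_norm hu_norm hu_im
    (by rw [hp0]; rfl) (by rw [hp1]; rfl) (by rw [hp2]; rfl) (by rw [hp3]; rfl)
  refine ⟨R, φ, x, hUx, ?_⟩
  rw [hcrx, hu_re]
  norm_num

/-- The constant family `c` has Cardy limits in every conformal rectangle only if `c = F(1/4)`;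
in particular neither `0` nor `1/2` does. [folklore] -/
theorem const_hasCrossingLimit_imp {c : ℝ}
    (h : ∀ R : ConformalRectangle, R.HasCrossingLimit (fun _ ↦ c) cardyFunction) :
    c = cardyFunction (1 / 4) := by
  obtain ⟨R, φ, x, hUx, hcr⟩ := exists_rect_crossRatio_quarter
  have h1 := h R φ x hUx
  rw [hcr] at h1
  exact tendsto_nhds_unique tendsto_const_nhds h1

/-- (C1) MODEL-BLIND TRANSPORT IS FALSE: Cardy's formula for one family of crossing
probabilities does not imply it for another (`P :=` Cardy value of the modulus, `Q := 0`).  Any proof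
of the crux must use the lattice content of `P_IK` and of bond-ℤ². [folklore] -/
theorem not_blind_transport :
    ¬ ∀ P Q : ConformalRectangle → ℝ → ℝ,
      (∀ R : ConformalRectangle, R.HasCrossingLimit (P R) cardyFunction) →
        ∀ R : ConformalRectangle, R.HasCrossingLimit (Q R) cardyFunction := by
  intro H
  have hQ := H (fun R _ ↦ cardyFunction (eta R)) (fun _ _ ↦ (0 : ℝ)) hasCrossingLimit_cardy_eta
  have h0 := const_hasCrossingLimit_imp hQ
  linarith [cardyFunction_quarter_lt_half.1]

/-- (C2) SYMMETRY AND SELF-DUALITY OF THE TARGET DO NOT HELP WITHOUT A TRANSPORT: for every property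
`Symm` of crossing families that the constant family `½` enjoys — quarter-turn invariance
`Q (i•R) = Q R` (the shape of `IKQuarterTurn`), full dihedral and translation covariance, exact
self-duality `Q R δ + Q R† δ = 1`, `0 ≤ Q ≤ 1`, … — the implication "Cardy for `P` and `Symm Q` ⇒
Cardy for `Q`" fails (`Q := ½` has limit `½ ≠ F(1/4)` on the rectangle of modulus `1/4`).  The
route's closing sentence ("both ends are D₄-symmetric, so … closed by AnchorByRigidity-type
rigidity") therefore only removes the linear-map ambiguity AFTER a transport along the corner line
has been established; the transport is the entire content. [folklore] -/
theorem not_transport_under (Symm : (ConformalRectangle → ℝ → ℝ) → Prop)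
    (hhalf : Symm (fun _ _ ↦ 1 / 2)) :
    ¬ ∀ P Q : ConformalRectangle → ℝ → ℝ, Symm Q →
      (∀ R : ConformalRectangle, R.HasCrossingLimit (P R) cardyFunction) →
        ∀ R : ConformalRectangle, R.HasCrossingLimit (Q R) cardyFunction := by
  intro H
  have hQ := H (fun R _ ↦ cardyFunction (eta R)) (fun _ _ ↦ (1 / 2 : ℝ)) hhalf
    hasCrossingLimit_cardy_eta
  have h0 := const_hasCrossingLimit_imp hQ
  linarith [cardyFunction_quarter_lt_half.2]

/-! ## §D One-face algebra of the corner-fugacity weight: 3-wise independence, negative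
association, no stochastic order

The four cells around one grid vertex, `σ = (SW, SE, NW, NE)`, weighted by `t` if an odd number of
them is black and by `1` otherwise: this is the free corner-fugacity measure of a single face
(`Literature.Probability.LatticeModels.cornerGibbsMeasure` on a 2×2 box) and, with `p = t/(1+t)`,
EXACTLY the law of the four colours `blk ω f, blk ω (f+e₀), blk ω (f+e₁), blk ω (f+1)` of the
route's i.i.d. gauge (three of them i.i.d. fair, the fourth fixed by the Bernoulli(`p`) plaquette
parity).  Everything below is finite algebra over the 16 colourings. -/

/-- A colouring of the four cells `(SW, SE, NW, NE)` of one face. [folklore] -/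
abbrev Face : Type := Bool × Bool × Bool × Bool

/-- The face is odd (a corner / turning vertex of the domain walls) iff an odd number of its four
cells is black. [folklore] -/
def oddFace (σ : Face) : Bool := xor σ.1 (xor σ.2.1 (xor σ.2.2.1 σ.2.2.2))

/-- Corner-fugacity weight of one face: `t` if odd, `1` if even. [folklore] -/
def faceWeight (t : ℝ) (σ : Face) : ℝ := if oddFace σ then t else 1

/-- Unnormalised expectation `Σ_σ t^{[odd σ]} f(σ)`. [folklore] -/
def faceSum (t : ℝ) (f : Face → ℝ) : ℝ := ∑ σ : Face, faceWeight t σ * f σ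

/-- Partition function of one free face. [folklore] -/
def faceZ (t : ℝ) : ℝ := faceSum t fun _ ↦ 1

/-- Probability of an event of the four colours under the one-face corner-fugacity law. [folklore] -/
def faceProb (t : ℝ) (f : Face → ℝ) : ℝ := faceSum t f / faceZ t

/-- Indicator of a Boolean predicate as a real function. [folklore] -/
def ind (P : Face → Bool) : Face → ℝ := fun σ ↦ if P σ then 1 else 0

/-- The increasing event "the main diagonal carries a black cell": `SW ∨ NE`. [folklore] -/
def evMainOr : Face → Bool := fun σ ↦ σ.1 || σ.2.2.2

/-- The increasing event "the anti-diagonal is black": `SE ∧ NW`. [folklore] -/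
def evAntiAnd : Face → Bool := fun σ ↦ σ.2.1 && σ.2.2.1

/-- The increasing event "at least three of the four cells are black". [folklore] -/
def evThree : Face → Bool := fun σ ↦
  3 ≤ (σ.1.toNat + σ.2.1.toNat + σ.2.2.1.toNat + σ.2.2.2.toNat)

/-- The increasing event "all four cells are black". [folklore] -/
def evFour : Face → Bool := fun σ ↦ σ.1 && σ.2.1 && σ.2.2.1 && σ.2.2.2

/-- `Z = 8 + 8t` (eight even and eight odd colourings). [folklore] -/
theorem faceZ_eq (t : ℝ) : faceZ t = 8 + 8 * t := by
  simp [faceZ, faceSum, faceWeight, oddFace, Fintype.sum_prod_type]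
  ring

/-- 3-WISE INDEPENDENCE: for every prescribed colouring of three of the four cells the total weight
of the two completions is `1 + t`, i.e. any three cells of a face are i.i.d. fair (probability
`(1+t)/(8(1+t)) = 1/8` each pattern) for EVERY `t` — pairwise and three-point statistics of the
colour field do not see `t`.  This is no lever for crossings: k-wise independence with fair
marginals does not pin the crossing probability of the `n × n` grid for any fixed `k` (Benjamini,
Gurel-Gurevich, Peled, arXiv:1201.3261, §4.6, Thm 19–20: `K₁(crossing) ≥ 2^{√(log log n)}`), so the
`t`-blindness of low-order statistics is consistent with ANY large-scale behaviour. [folklore] -/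
theorem face_three_cells_uniform (t : ℝ) (a b c : Bool) :
    (faceWeight t (a, b, c, true) + faceWeight t (a, b, c, false) = 1 + t) ∧
    (faceWeight t (a, b, true, c) + faceWeight t (a, b, false, c) = 1 + t) ∧
    (faceWeight t (a, true, b, c) + faceWeight t (a, false, b, c) = 1 + t) ∧
    (faceWeight t (true, a, b, c) + faceWeight t (false, a, b, c) = 1 + t) := by
  cases a <;> cases b <;> cases c <;> simp [faceWeight, oddFace] <;> ring

/-- Unnormalised moments of the two diagonal events: `Σ w·f·g = 1 + 2t`, `Σ w·f = 6 + 6t`,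
`Σ w·g = 2 + 2t`. [folklore] -/
theorem face_moments (t : ℝ) :
    faceSum t (fun σ ↦ ind evMainOr σ * ind evAntiAnd σ) = 1 + 2 * t ∧
    faceSum t (ind evMainOr) = 6 + 6 * t ∧ faceSum t (ind evAntiAnd) = 2 + 2 * t := by
  refine ⟨?_, ?_, ?_⟩ <;>
    simp [faceSum, faceWeight, oddFace, ind, evMainOr, evAntiAnd, Fintype.sum_prod_type] <;> ring

/-- NEGATIVE ASSOCIATION on one face for `0 ≤ t < 1` (hence at the IK point `t = √3/2` and at the
freezing point `t = 0`): the increasing events `{SW ∨ NE black}` and `{SE ∧ NW black}` satisfy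
`E[fg]·Z < E[f]·E[g]` in unnormalised form, i.e. `Cov(f,g) < 0`.  So the corner-fugacity field
(equivalently the route's i.i.d. gauge, whose 2×2 marginal this is) is NOT positively associated:
no Harris–FKG inequality, and FKG-based RSW gluing / Grimmett–Manolescu box-crossing transport do
not apply verbatim anywhere on `[0,1)`. [folklore] -/
theorem face_negative_association {t : ℝ} (ht0 : 0 ≤ t) (ht1 : t < 1) :
    faceSum t (fun σ ↦ ind evMainOr σ * ind evAntiAnd σ) * faceZ t <
      faceSum t (ind evMainOr) * faceSum t (ind evAntiAnd) := by
  obtain ⟨h1, h2, h3⟩ := face_moments t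
  rw [h1, h2, h3, faceZ_eq]
  nlinarith

/-- The covariance in closed form: `Cov_t(f,g) = E[fg] − E[f]E[g] = −(1−t)/(16(1+t))`
(`= −ρ/16`, `ρ = (1−t)/(1+t) = 1 − 2p`, the face value quoted in the route's why-might-fail). [folklore] -/
theorem face_cov_formula {t : ℝ} (ht : 0 ≤ t) :
    faceProb t (fun σ ↦ ind evMainOr σ * ind evAntiAnd σ) -
        faceProb t (ind evMainOr) * faceProb t (ind evAntiAnd) =
      -(1 - t) / (16 * (1 + t)) := by
  obtain ⟨h1, h2, h3⟩ := face_moments t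
  simp only [faceProb, h1, h2, h3, faceZ_eq]
  have h : (8 + 8 * t) ≠ 0 := by positivity
  field_simp
  ring

/-- Unnormalised weights of `{≥ 3 black}` (`1 + 4t`) and `{4 black}` (`1`). [folklore] -/
theorem face_tail_moments (t : ℝ) :
    faceSum t (ind evThree) = 1 + 4 * t ∧ faceSum t (ind evFour) = 1 := by
  refine ⟨?_, ?_⟩ <;>
    simp [faceSum, faceWeight, oddFace, ind, evThree, evFour, Fintype.sum_prod_type]
  ring

/-- NO STOCHASTIC ORDER ALONG THE CORNER LINE: for `0 ≤ t < t'` the increasing event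
`{≥ 3 of the 4 cells black}` is MORE likely at `t'` while the increasing event `{all 4 black}` is
LESS likely at `t'`.  Hence neither `M(t,½) ≼ M(t',½)` nor `M(t',½) ≼ M(t,½)` (already on one
face, which is the 2×2 marginal of the infinite-volume gauge), and — all one-cell marginals being
`½` — Strassen's theorem says no monotone coupling in `t` exists at all: CornerIrrelevance cannot be a
Russo / Grimmett–Manolescu monotone interpolation in `t`. [folklore] -/
theorem face_no_stochastic_order {t t' : ℝ} (ht : 0 ≤ t) (htt' : t < t') :
    faceProb t (ind evThree) < faceProb t' (ind evThree) ∧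
      faceProb t' (ind evFour) < faceProb t (ind evFour) := by
  obtain ⟨a1, a2⟩ := face_tail_moments t
  obtain ⟨b1, b2⟩ := face_tail_moments t'
  simp only [faceProb, a1, a2, b1, b2, faceZ_eq]
  have hZ : (0 : ℝ) < 8 + 8 * t := by positivity
  have hZ' : (0 : ℝ) < 8 + 8 * t' := by linarith
  constructor
  · rw [div_lt_div_iff₀ hZ hZ']
    nlinarith
  · rw [div_lt_div_iff₀ hZ' hZ]
    nlinarith

/-- Every single cell is black with probability `½` for every `t` (colour-flip symmetry; here by
summing the weights: `Σ_{SW black} w = 4 + 4t = Z/2`). [folklore] -/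
theorem face_one_cell_half (t : ℝ) (ht : 0 ≤ t) :
    faceProb t (ind fun σ ↦ σ.1) = 1 / 2 := by
  have h : faceSum t (ind fun σ ↦ σ.1) = 4 + 4 * t := by
    simp [faceSum, faceWeight, oddFace, ind, Fintype.sum_prod_type]
    ring
  simp only [faceProb, h, faceZ_eq]
  have hZ : (8 + 8 * t) ≠ 0 := by positivity
  field_simp
  ring

/-! ## §E Numerics along the corner line (kit compute; exact sampling of the i.i.d. gauge) -/

/-- NUMERICS (cycle 1).  (i) EXACT small boxes (pure enumeration of the free corner-fugacity
measure with fair coins, this unit; sanity: every square box is exactly `½` for every `t`, and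
`P[3×2 LR] + P[2×3 LR] = 1` by duality): `P[LR black crossing of a 4×2 box]` =
`31/128 = 0.2422 (t=0)`, `9/40 = 0.2250 (t=¼)`, `2/9 = 0.2222 (t=½)`, `0.2234 (t=¾)`,
`231/1024 = 0.2256 (t=1)`; `4×3 box`: `0.3853, 0.3744, 0.3735, 0.3747, 0.3761` — finite-mesh
t-independence is false (as expected) and the dependence is NON-MONOTONE in `t` with the plaid end
`t = 0` the most connected at small scales (long straight runs).  Also checked exactly on the 3×3
box: the box law of the i.i.d. gauge IS the free corner-fugacity measure `∝ t^{#odd inner vertices}`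
(`t = p/(1−p)`), `Cov = −(1−t)/(16(1+t))`, and the four corners of an `a × b` rectangle of cells have
`E[(−1)^{Σ colours}] = ρ^{ab}`, `ρ = (1−t)/(1+t)` (4-point correlations decay exponentially in the
AREA; all 2- and 3-point functions vanish).  (i′) EXACT signed influence of ONE forced corner (one
dislocation) in the plaid background `t = 0`, LR crossing: `4×2` box `P₀ = 31/128`, centre vertex
`I_f = −7/128 = −0.0547`, edge vertices `−0.0391`; `6×3` box `P₀ = 0.2340`, central vertices
`I_f = −0.0319`, next `−0.0279`, near the short sides `−0.0155` — every single dislocation LOWERS the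
long-way crossing at these sizes, all signs equal (no cancellation in `Σ_f I_f` at small `L`; ratio
centre `6×3 / 4×2 = 0.58 ≈ (2/3)^{1.3}`), consistent with the exact `P(t)` decreasing away from
`t = 0`.  (ii) MONTE CARLO T-SCAN (kit `j013834`/`j013840`/`j013842`/`j013845`, four 1-core parts,
evidence `compute-j0138xx.json` on the item; sampler = exact i.i.d.-gauge sampling, validated by pilot
`j008193`: Cardy `0.175647` reproduced from the elliptic-modulus formula, exactly-self-dual squares
measured `0.493–0.506 ± 0.0035` at `L ≤ 128` for all `t`).  Long-way black crossing of `2L × L`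
cell boxes, free boundary, `P̂ (z vs Cardy 0.1756)`, standard errors `0.0017 (L ≤ 64, n = 5·10⁴)`,
`0.0024 (L = 128)`, `0.0038 (L = 256)`, `0.006 (L = 512, n = 4000)`; cells marked `*` are pooled
with the deep re-runs of (d) (`se .0016–.003`):

    t \ L      16           32           64           128          256          512
    0        .1896(+8.1)  .1830(+4.3)  .1769(+0.7)  .1748(−0.3)  .1773(+0.4)  .1746(−0.3)*
    0.02     .1855(+5.6)  .1741(−0.9)  .1752(−0.3)  .1720(−1.5)  .1738(−0.5)  .1815(+1.0)
    0.05     .1785(+1.7)  .1739(−1.0)  .1790(+2.0)  .1717(−1.6)  .1738(−0.5)  .1680(−1.3)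
    0.1      .1756(−0.1)  .1738(−1.1)  .1731(−1.5)  .1734(−1.0)  .1723(−0.9)  .1790(+0.6)
    0.25     .1754(−0.2)  .1740(−1.0)  .1732(−1.4)  .1776(+0.8)  .1811(+1.4)  .1810(+0.9)
    0.5      .1825(+4.0)  .1765(+0.5)  .1780(+1.4)  .1736(−0.8)  .1753(−0.1)  .1703(−0.9)
    √3/2     .1834(+4.6)  .1806(+2.9)  .1757(+0.0)  .1739(−0.7)  .1757(+0.0)* .1781(+1.0)*
    1        .1870(+6.6)  .1809(+3.1)  .1793(+2.1)  .1782(+1.1)  .1750(−0.2)  .1756(−0.0)*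

READING.  (a) Every member of the corner line, the frozen end `t = 0` (bond-ℤ² on the renewal grid)
and the IK point included, reaches Cardy's `2:1` value within `±0.004` by `L = 64–128`; pooled
`L ≥ 128` per `t`: `.1744, .1735, .1719, .1737, .1788, .1737, .1717, .1780 (±.0019)`, overall
`0.1745 ± 0.0007` (Cardy `0.1756`).  No `t`-dependence of the large-scale value is resolved at the
`0.004` level — CornerIrrelevance is NOT numerically challenged.  (b) CROSSOVER: at small `t` the rows
are FLAT across `c = pL ∈ [0.6, 100]` (`t = 0.02: .174–.182`; `t = 0.1: .172–.179`;
`t = 0.25: .173–.181`) — no intermediate-scale bump `≥ 0.005` between the dislocation spacing and the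
colour correlation length: numerical support for the flat crossover function that `RegimeOne` /
`LevelCoherence` (cards `dislocation-gas-endgame`, `poisson-corner-refinement-tower`) presuppose.
(c) FINITE SIZE: the `L = 16` excess is `+0.008…+0.014` at `t ∈ {0, 0.02, 0.5, √3/2, 1}` but ABSENT at
`t ∈ {0.1, 0.25}` — the leading finite-size correction changes sign/non-monotonically along the line
(cf. the exact small boxes in (i)), a warning for any argument that wants corrections uniform in `t`.
(d) RESOLVED CAVEAT: the first-pass `L = 512` row (`n = 4000` per `t`) was mildly over-dispersed
across `t` (`χ² ≈ 15/7`), with the IK point at `.1610 (−2.5σ)` after a monotone-looking descent and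
`t = 0` at `.1640` — the one pattern in the whole scan that could have borne on the route's kill
criterion (i) (`CardyIK`).  Deep independent re-runs (`j014416`: IK point, `L = 256/512`,
`5·10⁴/2·10⁴` samples, seed 777; `j014436`: `t = 0, 1`, `L = 512`, `1.2·10⁴` each, seed 778) give
IK `L = 256: .1767 ± .0017`, `L = 512: .1816 ± .0027`; `t = 0, L = 512: .1782 ± .0035`;
`t = 1, L = 512: .1727 ± .0035` — every selected extreme regressed to Cardy (selection among 48 cells
explains the apparent 2–3σ first-pass/second-pass gaps; the pooled `L = 512` row
`.1746 .1815 .1680 .1790 .1810 .1703 .1781 .1756` has `χ² ≈ 5.4/7`).  FINAL IK-POINT VALUE (the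
`CardyIK` observable, `2:1` long-way crossing): pooled `L ≥ 128`, `1.09·10⁵` boxes,
`0.1758 ± 0.0012` against Cardy `0.17565` — agreement to `0.7 %`; kill criterion (i) does not fire,
and no member of the corner line is distinguishable from Cardy at the `±0.002–0.004` level reached.
(iii) SINGLE-DEFECT SIGNED INFLUENCE, BULK (kit `j013852`, paired MC, one forced corner at the
CENTRE vertex of a `2L × L` box, `I_f(L) = P[cross | κ_f odd] − P[cross | κ_f even]`, the summand
of the Russo formula of §G; exact anchors `L = 2, 3` from (i′)).  Background `t = 0` (one dislocation
inserted into renewal-grid bond percolation): `I_f = −0.0547 (L=2, exact)`, `−0.0319 (3, exact)`,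
`−0.00468 ± .00059 (8)`, `−0.00085 ± .00059 (12)`, `−0.00173 ± .00067 (16)`, `−0.00090 ± .00078 (24)`,
`+0.0002 ± .0009 (32)`, then `0 ± .001–.002` up to `L = 128`; high-precision re-run at `L = 16`
(`j015364`, `8·10⁶` pairs): `−0.001222 ± 0.000149` (`8.2σ`; slope `8 → 16` with it: `1.90`; `L = 8, 12`
re-runs `j015362`/`j015363` at `10⁷` pairs pending, to be folded in here).  Least-squares slope of `log|I_f|`
against `log L` over `L = 2…16`: `x_eff ≈ 1.9` (pairs: `2→8: 1.77`, `3→8: 1.96`, `2→16: 1.66`); a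
pure four-arm law `x = 5/4` anchored at `L = 2` predicts `.0097 (8)`, `.0058 (12)`, `.0041 (16)` and is
excluded at `8.4σ, 8.4σ, 3.5σ`.  Background `t = 0.1`: `|I_f| ≤ 3·10⁻⁴` already for `L = 8…24`
(`−.00016 ± .00059`, `+.00024`, `−.00024`, `+.00009`), `0 ± .001–.002` beyond (one `2.7σ` outlier at
`L = 96`).  The unsigned pathwise pivotality of the quadrant flip stays `Θ(1)`:
`piv = P[X₀ ≠ X₁] = 0.175 → 0.189`, `∝ L^{0.025}`.  READING for §G: in the BULK the signed response
of a crossing probability to one corner decays much faster than the four-arm rate — effective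
exponent `≈ 1.8–2` where it is measurable, sign constant (negative) at `t = 0`, and below `10⁻³` per
corner for `L ≥ 12` at `t = 0.1` — i.e. the data SUPPORT the selection rule of
`symmetric-seed-second-order` (zero four-arm amplitude; §G(4)'s `ι`-argument) and are consistent
with `RegimeOne`'s need `x₀ > 1`; they cannot distinguish `x = 2` from `x = 35/12`, nor exclude a
small-amplitude `5/4` tail below `±10⁻³`.  Order of magnitude check: `Σ_f I_f ≈ 2L²·Ī ≲ 0.15` at
`L = 16, t = 0.1`, matching the observed weak `t`-dependence of `P_L(t)` in (ii)
(`ΔP ≈ 0.01` over `Δp ≈ 0.18`).  BOUNDARY position (`j013862`, mid-point of the bottom row of vertices = on a free arc of the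
`2:1` box, where `ι` is broken): `t = 0`: `I_f = −.00668 ± .00072 (L=8)`, `−.00372 ± .00072 (12)`,
`−.00154 ± .00081 (16)`, `+.0001 ± .0009 (24)`, `0 ± .001–.003` beyond; effective exponent `8→16:
2.1`, a `1/L` tail anchored at `L = 8` is disfavoured (predicts `.0033 (16)`, `.0017 (32)` against
`.0015 ± .0008`, `−.0002 ± .0010`); `t = 0.1`: `|I_f| ≲ 10⁻³` at all `L` (signs alternate).  `piv`
is larger at the boundary, `0.256 → 0.276`.  This matches the THREE-arm half-plane exponent `2`
of boundary pivotality (§G(4) corrected): the boundary layer is harmless, the residual of the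
Russo wall is the bulk exponent alone.
Landed: `Theorems/CornerLineDescent/Negative/ModelBlindTransport.lean` (p73494),
`…/CornerFaceNoMonotone.lean` (p74036), `…/QuadrantFlipLocal.lean` (p74983, p75340) — all ACCEPTED.
[folklore] -/
theorem numerics_note : True := trivial

end Summit.CriticalPhenomena.CardyFormulaZ2.Cruxes.CornerLineDescent.Disproof
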